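import Summits.RiemannHypothesis.RiemannHypothesis.Theses.GroundBarta
import Literature.NumberTheory.LFunctions.WeilGroundState
import Literature.NumberTheory.LFunctions.WeilGroundEnergyProofs
import Literature.NumberTheory.LFunctions.WeilOddThetaVector
import Literature.NumberTheory.LFunctions.WeilThetaPhiMellin
import Literature.NumberTheory.LFunctions.WeilMarkovQuadratic
import Literature.NumberTheory.LFunctions.DeBruijnPhiDecreasing
import Literature.NumberTheory.LFunctions.WeilGroundStateRealZerosProofs

/-!
# Crux `GroundBarta.GroundBartaFloor` (stmt-RiemannHypothesis-18389) — line `phi-window-supersolution`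

Strategist line (planner, crux-strategist seat `cstrat-stmt-RiemannHypothesis-18389-s1`): the TRANSFER of
the proved odd twin `OddSector.OddBartaFloor` (stmt-17779, `Theorems/OddSectorOddBartaFloor*.lean`,
`OddBartaFloor_of`) to the full (parity-free) form, with the EVEN THETA VECTOR

  `K_a := 𝟙_{[−a,a]} · Φ`,  `Φ = weilThetaPhi` (Riemann's kernel, `Φ̂ = ξ`: `weilMellin_weilThetaPhi`),

in place of the odd probe `H_a = 𝟙_{[−a,a]}·(−Φ′)`.

MECHANISM. `Φ` is a NULL VECTOR of Weil's form (`Φ̂(ρ) = ξ(ρ) = 0`), so for a window test `g`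
(`tsupport g ⊆ [−a,a]`, any parity) only the off-diagonal image of the EVEN TAIL `Φ·𝟙_{|s|>a} ≥ 0`
survives:

  `W(g ⋆ K̃_a) = ∫ g · T_a`,  `T_a(t) = −2ϖ_a cosh(t/2) + P_a(t) + A_a(t)`,

`ϖ_a = ∫_{s>a} Φ(s)·2cosh(s/2) ds ≥ 0` (polar leakage, the ONLY negative term),
`P_a = Σ_n Λ(n) n^{-1/2} (tail_a(t − log n) + tail_a(t + log n)) ≥ 0`,
`A_a = ∫ tail_a(s) w(|t − s|) ds ≥ 0` (`w = weilArchDensity > 0`; Bombieri's off-diagonal kernel is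
`−w`). Hence the pointwise SUPERSOLUTION INEQUALITY on the open window, with NO prime-layer floor
(the step that was hardest for the odd twin, `stub_primeLayerFloor`, disappears):

  `T_a(t) ≥ −2ϖ_a cosh(a/2) ≥ −e(a) Φ(t) = −e(a) K_a(t)`,  `e(a) := 2ϖ_a cosh(a/2)/Φ(a)`  (`t ∈ (−a,a)`),

(`Φ` even, strictly decreasing on `[0,∞)`: `strictAntiOn_weilThetaPhi`), and `e(a) → 0`
(`≈ e^{−a}/(2π)`; refuter's float table: `e(1) = 0.116`, `e(2) = 0.028`, `e(4) = 3.0e−3`) from a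
termwise `Φ`-ratio bound `Φ(s₂) ≤ exp(−(2πe^{2s₁} − 5)(s₂ − s₁)) Φ(s₁)` (`1/2 ≤ s₁ ≤ s₂`,
`weilThetaPhi_eq_tsum`). BARTA at a good window `a` (bottom state `u`, `Im u = 0`, `Re u ≥ 0` a.e. on
`(−a,a)`): the weak Euler–Lagrange identity against the BV probe `K_a` and the transport identity give
`ε(a) ∫ Re u·K_a = ∫ Re u·T_a ≥ −e(a) ∫ Re u·K_a` and `∫ Re u·K_a > 0`, so `ε(a) ≥ −e(a)`, whence
`Re Q(h) ≥ ε(a) ≥ −e(a)` on the normalised sphere of the window.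

SKELETON. Six registered stubs (`stub_*`, each a genuine lemma of the line with its odd template named
in the docstring) and the sorry-free composition `GroundBartaFloor_of` concluding the crux BY NAME.
The junk-free ground-state clause of the crux is converted to `IsWeilGroundState` by the two lemmas of
the refuter's `Cruxes/GroundBartaFloor/GroundBartaFloorLogic.lean` (copied here, that file is a
workfile and not an import target).
-/

set_option linter.dupNamespace false

noncomputable section

open Set MeasureTheory Filter Complex
open scoped Real Topology ComplexConjugate ArithmeticFunction.vonMangoldt ENNReal

namespace Summit.RiemannHypothesis.RiemannHypothesis.Cruxes.GroundBartaFloor.PhiWindowSupersolution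

open Literature.NumberTheory.LFunctions
open Summit.RiemannHypothesis.RiemannHypothesis.Theses.GroundBarta

/-! ## The objects of the line -/

/-- The EVEN THETA VECTOR `K_a := 𝟙_{[−a,a]} · Φ` (window truncation of the null vector `Φ`). -/
def groundThetaVector (a : ℝ) : ℝ → ℝ :=
  (Icc (-a) a).indicator weilThetaPhi

/-- The EVEN TAIL `tail_a := Φ − K_a = 𝟙_{|s|>a} · Φ ≥ 0`. -/
def groundThetaTail (a : ℝ) (s : ℝ) : ℝ :=
  weilThetaPhi s - groundThetaVector a s

/-- The truncated tail `tail_{a,b} := K_b − K_a = 𝟙_{a<|s|≤b} · Φ` (`a ≤ b`). -/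
def groundThetaTailTrunc (a b : ℝ) (s : ℝ) : ℝ :=
  groundThetaVector b s - groundThetaVector a s

/-- The POLAR WEIGHT `ϖ_a := ∫_{s>a} Φ(s)·2cosh(s/2) ds` (`= tail_a^(0) = tail_a^(1)`). -/
def groundThetaPolarWeight (a : ℝ) : ℝ :=
  ∫ s in Ioi a, weilThetaPhi s * (2 * Real.cosh (s / 2))

/-- The truncated polar weight `ϖ_{a,b} := ∫_{a<s≤b} Φ(s)·2cosh(s/2) ds`. -/
def groundThetaPolarWeightTrunc (a b : ℝ) : ℝ :=
  ∫ s in Ioc a b, weilThetaPhi s * (2 * Real.cosh (s / 2))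

/-- The PRIME LAYER `P_a(t) := Σ_n Λ(n) n^{-1/2} (tail_a(t − log n) + tail_a(t + log n)) ≥ 0`. -/
def groundThetaPrimeLayer (a : ℝ) (t : ℝ) : ℝ :=
  ∑' n : ℕ, (Λ n : ℝ) / Real.sqrt n * (groundThetaTail a (t - Real.log n) + groundThetaTail a (t + Real.log n))

/-- The truncated prime layer (same with `tail_{a,b}`; a finitely supported sum). -/
def groundThetaPrimeLayerTrunc (a b : ℝ) (t : ℝ) : ℝ :=
  ∑' n : ℕ, (Λ n : ℝ) / Real.sqrt n *
    (groundThetaTailTrunc a b (t - Real.log n) + groundThetaTailTrunc a b (t + Real.log n))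

/-- The ARCHIMEDEAN LAYER `A_a(t) := ∫ tail_a(s) w(|t − s|) ds ≥ 0`, `w = weilArchDensity`
(logarithmically singular as `t → ±a`; a real Bochner integral). -/
def groundThetaArchLayer (a : ℝ) (t : ℝ) : ℝ :=
  ∫ s, groundThetaTail a s * weilArchDensity |t - s|

/-- The truncated archimedean layer (same with `tail_{a,b}`). -/
def groundThetaArchLayerTrunc (a b : ℝ) (t : ℝ) : ℝ :=
  ∫ s, groundThetaTailTrunc a b s * weilArchDensity |t - s|

/-- The WINDOW IMAGE `T_a(t) := −2ϖ_a cosh(t/2) + P_a(t) + A_a(t)` of the even theta vector: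
`W(g ⋆ K̃_a) = ∫ g T_a` for window tests `g`. -/
def groundThetaImage (a : ℝ) (t : ℝ) : ℝ :=
  -(2 * groundThetaPolarWeight a * Real.cosh (t / 2)) + groundThetaPrimeLayer a t + groundThetaArchLayer a t

/-- The truncated window image `T_{a,b}`: `W(g ⋆ K̃_b) − W(g ⋆ K̃_a) = −∫ g T_{a,b}` (`a ≤ b`). -/
def groundThetaImageTrunc (a b : ℝ) (t : ℝ) : ℝ :=
  -(2 * groundThetaPolarWeightTrunc a b * Real.cosh (t / 2)) + groundThetaPrimeLayerTrunc a b t +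
    groundThetaArchLayerTrunc a b t

/-- The explicit BARTA RATE `e(a) := 2ϖ_a cosh(a/2) / Φ(a)` (`≈ e^{−a}/(2π)`). -/
def groundBartaRate (a : ℝ) : ℝ :=
  2 * groundThetaPolarWeight a * Real.cosh (a / 2) / weilThetaPhi a

/-! ## The registered stubs -/

/-- **stub T1 — theta null** (`M`; odd template `Theorems/OddSectorOddBartaFloorThetaNull.lean`,
`stub_thetaNull`, with `weilMellin_weilThetaPhi` (`Φ̂ = ξ`) for `weilMellin_weilThetaPhiDeriv`): for every
test `g`, `W(g ⋆ K̃_b) → 0` as `b → ∞` — compact explicit formula `explicit_formula_holds` for the test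
`g ⋆ K̃_b`, `K̂_b → Φ̂ = ξ` uniformly on the critical strip (`integrable_weilThetaPhi_mul_cexp`), the zero
side summable (`weilZeroSummable`, `norm_weilMellin_le_pow_of_abs_re_le`), and `ξ(1 − ρ̄) = 0`. -/
theorem stub_groundThetaNull :
    ∀ g : ℝ → ℂ, IsWeilTest g →
      Tendsto (fun b : ℝ => weilFunctional (weilConv g (weilReflect fun t => ((groundThetaVector b t : ℝ) : ℂ))))
        atTop (𝓝 0) := by
  sorry

/-- **stub T2 — truncated transport identity** (`L`; odd templates `…TailPolar`, `…TailPrime`,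
`…TailArchBombieri`, `…TailArchFubini`, first half of `…Transport`): for `0 < a ≤ b` and a window test
`g` (`tsupport g ⊆ [−a,a]`, ANY parity), `W(g ⋆ K̃_b) − W(g ⋆ K̃_a) = W(g ⋆ tail_{a,b}~) = −∫ g T_{a,b}`:
the off-diagonal window computation for the bounded compactly supported even tail
`tail_{a,b} = 𝟙_{a<|s|≤b}Φ` — polar part `+2ϖ_{a,b} cosh(t/2)` (`tail^(0) = tail^(1) = ϖ_{a,b}` by
evenness), prime part `−P_{a,b}`, archimedean part `−A_{a,b}` through Bombieri's form
`weilArchTermBombieri_eq_weilArchTerm_holds` (kernel `−w(|t|)` off the diagonal, `k(0) = 0`). -/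
theorem stub_groundTransportTrunc :
    ∀ (a b : ℝ) (g : ℝ → ℂ), 0 < a → a ≤ b → IsWeilTest g → tsupport g ⊆ Icc (-a) a →
      weilFunctional (weilConv g (weilReflect fun t => ((groundThetaVector b t : ℝ) : ℂ))) -
          weilFunctional (weilConv g (weilReflect fun t => ((groundThetaVector a t : ℝ) : ℂ))) =
        -∫ t, g t * ((groundThetaImageTrunc a b t : ℝ) : ℂ) := by
  sorry

/-- **stub T3 — tail limit of the pairings** (`M`; odd templates `…TailUniform` (`T_{a,b} → T_a`
uniformly on `(−a,a)`: super-exponential tails of `Φ` beyond `b`, `weilThetaPhi_le_exp`) and the second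
half of `…Transport` (integrability of `g·T` through `stub_groundImageMemLp`-type bounds)): for a window
test `g`, `∫ g T_{a,b} → ∫ g T_a` as `b → ∞`. -/
theorem stub_groundTailLimit :
    ∀ (a : ℝ) (g : ℝ → ℂ), 0 < a → IsWeilTest g → tsupport g ⊆ Icc (-a) a →
      Tendsto (fun b : ℝ => ∫ t, g t * ((groundThetaImageTrunc a b t : ℝ) : ℂ)) atTop
        (𝓝 (∫ t, g t * ((groundThetaImage a t : ℝ) : ℂ))) := by
  sorry

/-- **stub F — the window image is square integrable on the open window** (`M`; odd template
`…ImageMemLp`): `𝟙_{(−a,a)} T_a ∈ L²` — `P_a` is bounded on the window (theta-summable translates,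
`weilThetaPhi_le_exp`), `A_a` is continuous inside with a logarithmic edge singularity
`≈ (Φ(a)/2) log(1/(a − |t|))` (`w(r) ~ 1/(2r)`), square integrable. -/
theorem stub_groundImageMemLp :
    ∀ a : ℝ, 0 < a → MemLp (fun t => (Ioo (-a) a).indicator (groundThetaImage a) t) 2 volume := by
  sorry

/-- **stub D — decay of the Barta rate** (`M`; odd templates `…PhiRatio` + `…TailPolar`): `e(a) =
2ϖ_a cosh(a/2)/Φ(a) → 0` as `a → ∞`. Route: the termwise ratio bound
`Φ(s₂) ≤ exp(−(2πe^{2s₁} − 5)(s₂ − s₁)) Φ(s₁)` for `1/2 ≤ s₁ ≤ s₂` (each term of `weilThetaPhi_eq_tsum`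
has logarithmic derivative `≤ 9/2 + 2/((2/3)πe^{2s}n² − 1) − 2πn²e^{2s}`), whence
`ϖ_a ≤ 4Φ(a)e^{a/2}/(2πe^{2a} − 11/2)` and `e(a) ≤ 8e^{a}/(2πe^{2a} − 11/2)`. -/
theorem stub_groundRateDecay :
    Tendsto (fun a : ℝ => 2 * groundThetaPolarWeight a * Real.cosh (a / 2) / weilThetaPhi a)
      atTop (𝓝 0) := by
  sorry

/-- **stub V — weak Euler–Lagrange identity against the BV probe `K_a`** (`L`; odd template
`…EulerLagrange` (`stub_asmEulerLagrange`) with `…ThetaApproximants`; REUSABLE BY NAME: the parity-free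
`OddBartaFloor.stub_polarContinuity`, `OddBartaFloor.stub_energyBound`, and, replacing the odd polar
defect, the full `ConnesVanSuijlekom.abs_polar_le` / `GroundStatesConvergeToXi.groundState_eulerLagrange`):
along a minimising sequence `gₙ → u` of the window, `W(gₙ ⋆ K̃_a) → ε(a) ∫ u K_a` — smooth cut-offs
`θ_m Φ → K_a` inside the window with uniformly bounded energies (a jump of height `Φ(a)` has finite
Dirichlet energy, `w(r) ~ 1/(2r)`; Bombieri 2000 Lemma 1), Cauchy–Schwarz polar bound uniformly in `m`,
continuity of `h ↦ W(g ⋆ h̃)` under dominated convergence. -/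
theorem stub_groundEulerLagrange :
    ∀ (a : ℝ) (u : ℝ → ℂ) (g : ℕ → ℝ → ℂ), 0 < a →
      (∀ n, IsWeilTest (g n) ∧ tsupport (g n) ⊆ Icc (-a) a ∧ ∫ t, ‖g n t‖ ^ 2 = (1 : ℝ)) →
      Tendsto (fun n => (weilQuadratic (g n)).re) atTop (𝓝 (weilGroundEnergy a)) →
      MemLp u 2 volume → Tendsto (fun n => ∫ t, ‖g n t - u t‖ ^ 2) atTop (𝓝 0) →
      Tendsto (fun n => weilFunctional (weilConv (g n)
          (weilReflect fun t => ((groundThetaVector a t : ℝ) : ℂ)))) atTop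
        (𝓝 ((weilGroundEnergy a : ℂ) * ∫ t, u t * ((groundThetaVector a t : ℝ) : ℂ))) := by
  sorry

/-! ## Elementary facts about the even theta vector -/

theorem groundThetaVector_of_mem {a t : ℝ} (ht : t ∈ Icc (-a) a) :
    groundThetaVector a t = weilThetaPhi t :=
  indicator_of_mem ht _

theorem groundThetaVector_of_not_mem {a t : ℝ} (ht : t ∉ Icc (-a) a) : groundThetaVector a t = 0 :=
  indicator_of_notMem ht _

theorem groundThetaVector_nonneg (a t : ℝ) : 0 ≤ groundThetaVector a t := by
  by_cases ht : t ∈ Icc (-a) a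
  · rw [groundThetaVector_of_mem ht]; exact (weilThetaPhi_pos t).le
  · rw [groundThetaVector_of_not_mem ht]

theorem groundThetaVector_pos {a t : ℝ} (ht : t ∈ Icc (-a) a) : 0 < groundThetaVector a t := by
  rw [groundThetaVector_of_mem ht]; exact weilThetaPhi_pos t

theorem measurable_groundThetaVector (a : ℝ) : Measurable (groundThetaVector a) :=
  continuous_weilThetaPhi.measurable.indicator measurableSet_Icc

/-- `|K_a| ≤ Φ(0)` (`Φ` is maximal at `0`). -/
theorem abs_groundThetaVector_le (a t : ℝ) : |groundThetaVector a t| ≤ weilThetaPhi 0 := by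
  rw [abs_of_nonneg (groundThetaVector_nonneg a t)]
  by_cases ht : t ∈ Icc (-a) a
  · rw [groundThetaVector_of_mem ht]
    rcases eq_or_ne t 0 with rfl | h0
    · exact le_rfl
    · exact (weilThetaPhi_lt_weilThetaPhi_zero h0).le
  · rw [groundThetaVector_of_not_mem ht]; exact (weilThetaPhi_pos 0).le

/-- `K_a ∈ L²` (bounded, supported in the window). -/
theorem memLp_groundThetaVector (a : ℝ) : MemLp (groundThetaVector a) 2 volume := by
  have htop : MemLp (groundThetaVector a) ∞ volume :=
    memLp_top_of_bound (measurable_groundThetaVector a).aestronglyMeasurable (weilThetaPhi 0)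
      (Eventually.of_forall fun t => by rw [Real.norm_eq_abs]; exact abs_groundThetaVector_le a t)
  exact htop.mono_exponent_of_measure_support_ne_top (s := Icc (-a) a)
    (fun _ ht => groundThetaVector_of_not_mem ht) (by simp [Real.volume_Icc]) le_top

/-- `Φ(a) ≤ Φ(t)` for `|t| ≤ a` (`Φ` even and decreasing on `[0, ∞)`). -/
theorem weilThetaPhi_le_of_abs_le {a t : ℝ} (h : |t| ≤ a) : weilThetaPhi a ≤ weilThetaPhi t := by
  have ht : weilThetaPhi t = weilThetaPhi |t| := by
    rcases le_or_gt 0 t with h0 | h0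
    · rw [abs_of_nonneg h0]
    · rw [abs_of_neg h0, weilThetaPhi_neg]
  rw [ht]
  exact strictAntiOn_weilThetaPhi.antitoneOn (show |t| ∈ Ici (0 : ℝ) from abs_nonneg t)
    (show a ∈ Ici (0 : ℝ) from (abs_nonneg t).trans h) h

/-! ## Positivity of the layers and the supersolution inequality -/

theorem groundThetaTail_nonneg (a s : ℝ) : 0 ≤ groundThetaTail a s := by
  unfold groundThetaTail
  by_cases hs : s ∈ Icc (-a) a
  · rw [groundThetaVector_of_mem hs, sub_self]
  · rw [groundThetaVector_of_not_mem hs, sub_zero]; exact (weilThetaPhi_pos s).le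

theorem groundThetaPolarWeight_nonneg (a : ℝ) : 0 ≤ groundThetaPolarWeight a :=
  setIntegral_nonneg measurableSet_Ioi fun s _ =>
    mul_nonneg (weilThetaPhi_pos s).le (mul_nonneg zero_le_two (Real.cosh_pos _).le)

theorem groundThetaPrimeLayer_nonneg (a t : ℝ) : 0 ≤ groundThetaPrimeLayer a t :=
  tsum_nonneg fun _ => mul_nonneg
    (div_nonneg ArithmeticFunction.vonMangoldt_nonneg (Real.sqrt_nonneg _))
    (add_nonneg (groundThetaTail_nonneg _ _) (groundThetaTail_nonneg _ _))

theorem weilArchDensity_abs_nonneg (r : ℝ) : 0 ≤ weilArchDensity |r| := by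
  unfold weilArchDensity
  exact div_nonneg (Real.exp_pos _).le (mul_nonneg zero_le_two (Real.sinh_nonneg_iff.2 (abs_nonneg r)))

theorem groundThetaArchLayer_nonneg (a t : ℝ) : 0 ≤ groundThetaArchLayer a t :=
  integral_nonneg fun s => mul_nonneg (groundThetaTail_nonneg a s) (weilArchDensity_abs_nonneg _)

theorem groundBartaRate_nonneg (a : ℝ) : 0 ≤ groundBartaRate a :=
  div_nonneg (mul_nonneg (mul_nonneg zero_le_two (groundThetaPolarWeight_nonneg a)) (Real.cosh_pos _).le)
    (weilThetaPhi_pos a).le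

/-- **The supersolution inequality** `T_a ≥ −e(a) K_a` on the open window, `e(a) = groundBartaRate a`:
`T_a ≥ −2ϖ_a cosh(t/2) ≥ −2ϖ_a cosh(a/2) = −e(a)Φ(a) ≥ −e(a)Φ(t)`. -/
theorem groundThetaImage_floor {a : ℝ} (ha : 0 < a) {t : ℝ} (ht : t ∈ Ioo (-a) a) :
    -(groundBartaRate a) * groundThetaVector a t ≤ groundThetaImage a t := by
  have hΦa : 0 < weilThetaPhi a := weilThetaPhi_pos a
  have hta : |t| ≤ a := abs_le.2 ⟨ht.1.le, ht.2.le⟩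
  have hK : groundThetaVector a t = weilThetaPhi t := groundThetaVector_of_mem ⟨ht.1.le, ht.2.le⟩
  have hΦ : weilThetaPhi a ≤ weilThetaPhi t := weilThetaPhi_le_of_abs_le hta
  have hcosh : Real.cosh (t / 2) ≤ Real.cosh (a / 2) := by
    rw [Real.cosh_le_cosh, abs_div, abs_div, abs_two, abs_of_pos ha]
    exact div_le_div_of_nonneg_right hta zero_le_two
  have hϖ := groundThetaPolarWeight_nonneg a
  have hP := groundThetaPrimeLayer_nonneg a t
  have hA := groundThetaArchLayer_nonneg a t
  have h1 : 2 * groundThetaPolarWeight a * Real.cosh (t / 2) ≤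
      2 * groundThetaPolarWeight a * Real.cosh (a / 2) :=
    mul_le_mul_of_nonneg_left hcosh (by positivity)
  have h2 : 2 * groundThetaPolarWeight a * Real.cosh (a / 2) ≤
      2 * groundThetaPolarWeight a * Real.cosh (a / 2) / weilThetaPhi a * weilThetaPhi t := by
    rw [div_mul_eq_mul_div, le_div_iff₀ hΦa]
    exact mul_le_mul_of_nonneg_left hΦ (by positivity)
  rw [hK, groundThetaImage, groundBartaRate]
  linarith

/-! ## Transport: `W(g ⋆ K̃_a) = ∫ g T_a` for window tests (from stubs T1–T3) -/

theorem groundTransport {a : ℝ} (ha : 0 < a) {g : ℝ → ℂ} (hg : IsWeilTest g)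
    (hga : tsupport g ⊆ Icc (-a) a) :
    weilFunctional (weilConv g (weilReflect fun t => ((groundThetaVector a t : ℝ) : ℂ))) =
      ∫ t, g t * ((groundThetaImage a t : ℝ) : ℂ) := by
  set L : ℂ := weilFunctional (weilConv g (weilReflect fun t => ((groundThetaVector a t : ℝ) : ℂ)))
    with hL
  set Wb : ℝ → ℂ := fun b =>
    weilFunctional (weilConv g (weilReflect fun t => ((groundThetaVector b t : ℝ) : ℂ))) with hWb
  set Ib : ℝ → ℂ := fun b => ∫ t, g t * ((groundThetaImageTrunc a b t : ℝ) : ℂ) with hIb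
  have h1 : ∀ᶠ b : ℝ in atTop, Wb b + Ib b = L := by
    filter_upwards [eventually_ge_atTop a] with b hb
    have h := stub_groundTransportTrunc a b g ha hb hg hga
    simp only [hWb, hIb, hL] at h ⊢
    linear_combination h
  have h2 : Tendsto (fun b => Wb b + Ib b) atTop
      (𝓝 (0 + ∫ t, g t * ((groundThetaImage a t : ℝ) : ℂ))) :=
    (stub_groundThetaNull g hg).add (stub_groundTailLimit a g ha hg hga)
  rw [zero_add] at h2
  have h3 : Tendsto (fun _ : ℝ => L) atTop (𝓝 (∫ t, g t * ((groundThetaImage a t : ℝ) : ℂ))) :=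
    h2.congr' h1
  exact tendsto_nhds_unique tendsto_const_nhds h3

/-! ## The sphere of the window (two lemmas of the refuter's `GroundBartaFloorLogic`) -/

/-- `ε(a) ≤ Re Q(h)` on the normalised sphere of the window (refuter, `GroundBartaFloorLogic`). -/
theorem weilGroundEnergy_le_of_sphere {a : ℝ} {h : ℝ → ℂ} (hh : IsWeilTest h)
    (hsupp : tsupport h ⊆ Icc (-a) a) (hnorm : ∫ t, ‖h t‖ ^ 2 = (1 : ℝ)) :
    weilGroundEnergy a ≤ (weilQuadratic h).re :=
  csInf_le (bddBelow_weilQuadratic_sphere_holds a) ⟨h, hh, hsupp, hnorm, rfl⟩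

/-- The two forms of "minimising" agree on the bounded-below sphere (refuter, `GroundBartaFloorLogic`). -/
theorem forall_eventually_le_iff_tendsto_weilGroundEnergy {a : ℝ} {g : ℕ → ℝ → ℂ}
    (hg : ∀ n, IsWeilTest (g n) ∧ tsupport (g n) ⊆ Icc (-a) a ∧ ∫ t, ‖g n t‖ ^ 2 = (1 : ℝ)) :
    (∀ h : ℝ → ℂ, IsWeilTest h → tsupport h ⊆ Icc (-a) a → ∫ t, ‖h t‖ ^ 2 = (1 : ℝ) →
        ∀ δ : ℝ, 0 < δ → ∀ᶠ n in atTop, (weilQuadratic (g n)).re ≤ (weilQuadratic h).re + δ) ↔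
      Tendsto (fun n ↦ (weilQuadratic (g n)).re) atTop (𝓝 (weilGroundEnergy a)) := by
  set S : Set ℝ := {x : ℝ | ∃ g : ℝ → ℂ, IsWeilTest g ∧ tsupport g ⊆ Icc (-a) a ∧
    ∫ t : ℝ, ‖g t‖ ^ 2 = 1 ∧ x = (weilQuadratic g).re} with hSdef
  have hS : BddBelow S := bddBelow_weilQuadratic_sphere_holds a
  have hε : weilGroundEnergy a = sInf S := rfl
  have hmem : ∀ n, (weilQuadratic (g n)).re ∈ S := fun n ↦
    ⟨g n, (hg n).1, (hg n).2.1, (hg n).2.2, rfl⟩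
  have hne : S.Nonempty := ⟨_, hmem 0⟩
  have hlow : ∀ n, weilGroundEnergy a ≤ (weilQuadratic (g n)).re := fun n ↦
    hε ▸ csInf_le hS (hmem n)
  constructor
  · intro H
    rw [tendsto_order]
    refine ⟨fun x hx ↦ Eventually.of_forall fun n ↦ hx.trans_le (hlow n), fun x hx ↦ ?_⟩
    have hδ : 0 < (x - weilGroundEnergy a) / 2 := by linarith
    have hlt : sInf S < weilGroundEnergy a + (x - weilGroundEnergy a) / 2 := by
      rw [← hε]; linarith
    obtain ⟨y, ⟨h, hh, hsupp, hnorm, rfl⟩, hy⟩ := exists_lt_of_csInf_lt hne hlt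
    filter_upwards [H h hh hsupp hnorm _ hδ] with n hn
    linarith
  · intro H h hh hsupp hnorm δ hδ
    have hle : weilGroundEnergy a ≤ (weilQuadratic h).re := weilGroundEnergy_le_of_sphere hh hsupp hnorm
    have hev : ∀ᶠ n in atTop, (weilQuadratic (g n)).re < weilGroundEnergy a + δ :=
      (tendsto_order.1 H).2 _ (by linarith)
    filter_upwards [hev] with n hn
    linarith

/-! ## Barta's argument at a good window -/

/-- **Barta's inequality at a good window (full form).** If `T_a ≥ −e K_a` on `(−a, a)` with `e ≥ 0`,
and the window carries a bottom state `u` with `Im u = 0`, `Re u ≥ 0` a.e. on `(−a,a)`, then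
`ε(a) ≥ −e`: `ε ∫ Re u·K_a = ∫ Re u·T_a` (weak Euler–Lagrange against `K_a` + transport + the `L²`
pairing), the integrand `Re u·(T_a + eK_a)` is `≥ 0` a.e., and `∫ Re u·K_a > 0` because `u ≠ 0`. -/
theorem neg_le_weilGroundEnergy_of_floor {a e : ℝ} (ha : 0 < a) (he : 0 ≤ e)
    (hfl : ∀ t ∈ Ioo (-a) a, -e * groundThetaVector a t ≤ groundThetaImage a t)
    {u : ℝ → ℂ} (hu : IsWeilGroundState a u)
    (hsign : ∀ᵐ t : ℝ, t ∈ Ioo (-a) a → (u t).im = 0 ∧ 0 ≤ (u t).re) :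
    -e ≤ weilGroundEnergy a := by
  obtain ⟨hu2, g, hg, hQ, hL⟩ := (isWeilGroundState_iff a u).1 hu
  set ε : ℝ := weilGroundEnergy a with hε
  set K : ℝ → ℝ := groundThetaVector a with hK
  set Kc : ℝ → ℂ := fun t => ((K t : ℝ) : ℂ) with hKc
  set T : ℝ → ℝ := (Ioo (-a) a).indicator (groundThetaImage a) with hT
  set Tc : ℝ → ℂ := fun t => ((T t : ℝ) : ℂ) with hTc
  -- (1) Euler–Lagrange limit and transport identity
  have hEL := stub_groundEulerLagrange a u g ha hg hQ hu2 hL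
  have hTr : ∀ n, weilFunctional (weilConv (g n) (weilReflect Kc)) = ∫ t, g n t * Tc t := by
    intro n
    rw [hKc, hK, groundTransport ha (hg n).1 (hg n).2.1]
    refine integral_congr_ae ?_
    have hnull : (volume : Measure ℝ) {-a, a} = 0 :=
      (Set.toFinite _).measure_zero volume
    filter_upwards [measure_eq_zero_iff_ae_notMem.1 hnull] with t ht
    simp only [mem_insert_iff, mem_singleton_iff, not_or] at ht
    by_cases htm : t ∈ Ioo (-a) a
    · simp [hTc, hT, indicator_of_mem htm]
    · have hnot : t ∉ tsupport (g n) := fun h' => by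
        have h2 := (hg n).2.1 h'
        simp only [mem_Icc] at h2
        simp only [mem_Ioo, not_and_or, not_lt] at htm
        rcases htm with h3 | h3
        · exact ht.1 (le_antisymm h3 h2.1 ▸ rfl)
        · exact ht.2 (le_antisymm h2.2 h3)
      simp [image_eq_zero_of_notMem_tsupport hnot]
  -- (2) the pairing with the square-integrable image passes to the limit
  have hTmem : MemLp T 2 volume := stub_groundImageMemLp a ha
  have hTcmem : MemLp Tc 2 volume := hTmem.ofReal
  have hpair : Tendsto (fun n => ∫ t, g n t * Tc t) atTop (𝓝 (∫ t, u t * Tc t)) := by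
    have h1 := ConnesVanSuijlekom.tendsto_integral_mul_conj_left (u := Tc) hTcmem hu2
      (fun n => ConnesVanSuijlekom.isWeilTest_memLp (hg n).1) hL
    have hconj : ∀ t, conj (Tc t) = Tc t := fun t => by simp [hTc, Complex.conj_ofReal]
    simp only [hconj] at h1
    exact h1
  have hlimC : (ε : ℂ) * ∫ t, u t * Kc t = ∫ t, u t * Tc t := by
    have h2 : Tendsto (fun n => ∫ t, g n t * Tc t) atTop (𝓝 ((ε : ℂ) * ∫ t, u t * Kc t)) :=
      hEL.congr hTr
    exact tendsto_nhds_unique h2 hpair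
  -- (3) real parts: `ε ∫ Re u · K = ∫ Re u · T`
  set v : ℝ → ℝ := fun t => (u t).re with hv
  have hvmem : MemLp v 2 volume := by
    refine ⟨Complex.continuous_re.comp_aestronglyMeasurable hu2.1, ?_⟩
    refine lt_of_le_of_lt (eLpNorm_mono fun t => ?_) hu2.2
    simpa [hv, Real.norm_eq_abs] using Complex.abs_re_le_norm (u t)
  have hKmem : MemLp K 2 volume := memLp_groundThetaVector a
  have hiK : Integrable (fun t => v t * K t) := hvmem.integrable_mul hKmem
  have hiT : Integrable (fun t => v t * T t) := hvmem.integrable_mul hTmem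
  have hre : ∀ (F : ℝ → ℝ), MemLp F 2 volume →
      (∫ t, u t * ((F t : ℝ) : ℂ)).re = ∫ t, v t * F t := by
    intro F hF
    have hi : Integrable (fun t => u t * ((F t : ℝ) : ℂ)) := hu2.integrable_mul hF.ofReal
    have key := integral_re hi
    simp only [RCLike.re_to_complex] at key
    rw [← key]
    refine integral_congr_ae (Eventually.of_forall fun t => ?_)
    simp [hv, Complex.mul_re]
  have hlimR : ε * ∫ t, v t * K t = ∫ t, v t * T t := by
    have h3 := congrArg Complex.re hlimC
    rw [Complex.re_ofReal_mul, hre K hKmem, hre T hTmem] at h3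
    exact h3
  -- (4) sign information: `v ≥ 0` a.e., `T + eK ≥ 0` everywhere
  have hzero : ∀ᵐ t : ℝ, t ∉ Icc (-a) a → u t = 0 := hu.ae_eq_zero_of_notMem
  have hnull2 : (volume : Measure ℝ) {-a, a} = 0 := (Set.toFinite _).measure_zero volume
  have hae2 := measure_eq_zero_iff_ae_notMem.1 hnull2
  have hIoo_of : ∀ t : ℝ, t ∉ ({-a, a} : Set ℝ) → t ∈ Icc (-a) a → t ∈ Ioo (-a) a := by
    intro t ht hm
    simp only [mem_insert_iff, mem_singleton_iff, not_or] at ht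
    exact ⟨lt_of_le_of_ne hm.1 (fun h => ht.1 h.symm), lt_of_le_of_ne hm.2 (fun h => ht.2 h)⟩
  have hv_nonneg : ∀ᵐ t : ℝ, 0 ≤ v t := by
    filter_upwards [hsign, hzero, hae2] with t h1 h2 h3
    by_cases hm : t ∈ Icc (-a) a
    · exact (h1 (hIoo_of t h3 hm)).2
    · simp [hv, h2 hm]
  have hTK : ∀ t, 0 ≤ T t + e * K t := by
    intro t
    by_cases htm : t ∈ Ioo (-a) a
    · have := hfl t htm
      simp only [hT, indicator_of_mem htm, hK]
      linarith
    · simp only [hT, indicator_of_notMem htm, zero_add]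
      exact mul_nonneg he (groundThetaVector_nonneg a t)
  have hvK_nonneg : ∀ᵐ t : ℝ, 0 ≤ v t * K t :=
    hv_nonneg.mono fun t h => mul_nonneg h (groundThetaVector_nonneg a t)
  have hp_nonneg : ∀ᵐ t : ℝ, 0 ≤ v t * (T t + e * K t) :=
    hv_nonneg.mono fun t h => mul_nonneg h (hTK t)
  -- (5) `∫ v K > 0`
  have hI_pos : 0 < ∫ t, v t * K t := by
    rcases (integral_nonneg_of_ae hvK_nonneg).eq_or_lt with hz | hz'
    · exfalso
      have hvK0 : (fun t => v t * K t) =ᵐ[volume] 0 :=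
        (integral_eq_zero_iff_of_nonneg_ae hvK_nonneg hiK).1 hz.symm
      have hu0 : ∀ᵐ t : ℝ, u t = 0 := by
        filter_upwards [hvK0, hsign, hzero, hae2] with t h0 h1 h2 h3
        by_cases hm : t ∈ Icc (-a) a
        · have hto : t ∈ Ioo (-a) a := hIoo_of t h3 hm
          have hK0 : K t ≠ 0 := (groundThetaVector_pos hm).ne'
          simp only [Pi.zero_apply, mul_eq_zero] at h0
          have hvm : v t = 0 := h0.resolve_right hK0
          exact Complex.ext hvm (h1 hto).1
        · exact h2 hm
      have : ∫ t, ‖u t‖ ^ 2 = 0 := by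
        rw [← integral_zero (α := ℝ)]
        exact integral_congr_ae (hu0.mono fun t ht => by simp [ht])
      linarith [hu.integral_norm_sq]
    · exact hz'
  -- (6) integrate: `0 ≤ ∫ v (T + eK) = (ε + e) ∫ v K`
  have hint : 0 ≤ (ε + e) * ∫ t, v t * K t := by
    have h7 : 0 ≤ ∫ t, v t * (T t + e * K t) := integral_nonneg_of_ae hp_nonneg
    have h8 : ∫ t, v t * (T t + e * K t) = (∫ t, v t * T t) + e * ∫ t, v t * K t := by
      rw [← integral_const_mul, ← integral_add hiT (hiK.const_mul e)]
      refine integral_congr_ae (Eventually.of_forall fun t => ?_)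
      simp only
      ring
    rw [h8, ← hlimR] at h7
    linarith
  have h9 : 0 ≤ ε + e := (mul_nonneg_iff_of_pos_right hI_pos).1 hint
  linarith

/-! ## The crux -/

/-- **The ground Barta floor** (crux `GroundBarta.GroundBartaFloor`, stmt-RiemannHypothesis-18389), from
the six stubs: with `e = groundBartaRate` (`→ 0`, stub D) and `a₀ = 1`, at every window `a ≥ 1`
carrying a one-signed bottom state every normalised window test has `Re Q(h) ≥ ε(a) ≥ −e(a)`. -/
theorem GroundBartaFloor_of :
    Summit.RiemannHypothesis.RiemannHypothesis.Theses.GroundBarta.GroundBartaFloor := by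
  rw [show Summit.RiemannHypothesis.RiemannHypothesis.Theses.GroundBarta.GroundBartaFloor ↔
      (∃ e : ℝ → ℝ, Tendsto e atTop (nhds 0) ∧ ∃ a₀ : ℝ, ∀ a : ℝ, a₀ ≤ a →
        (∃ u : ℝ → ℂ, (MemLp u 2 ∧ ∃ g : ℕ → ℝ → ℂ,
            (∀ n, IsWeilTest (g n) ∧ tsupport (g n) ⊆ Icc (-a) a ∧ ∫ t, ‖g n t‖ ^ 2 = (1 : ℝ)) ∧
            (∀ h : ℝ → ℂ, IsWeilTest h → tsupport h ⊆ Icc (-a) a → ∫ t, ‖h t‖ ^ 2 = (1 : ℝ) →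
              ∀ δ : ℝ, 0 < δ → ∀ᶠ n in atTop, (weilQuadratic (g n)).re ≤ (weilQuadratic h).re + δ) ∧
            Tendsto (fun n => ∫ t, ‖g n t - u t‖ ^ 2) atTop (nhds 0)) ∧
          (∀ᵐ t : ℝ, t ∈ Ioo (-a) a → (u t).im = 0 ∧ 0 ≤ (u t).re)) →
        ∀ h : ℝ → ℂ, IsWeilTest h → tsupport h ⊆ Icc (-a) a →
          ∫ t, ‖h t‖ ^ 2 = (1 : ℝ) → -e a ≤ (weilQuadratic h).re) from Iff.rfl]
  refine ⟨groundBartaRate, stub_groundRateDecay, 1, fun a ha hgood h hh hs hnorm => ?_⟩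
  obtain ⟨u, ⟨hu2, g, hg, hmin, hL⟩, hsign⟩ := hgood
  have ha0 : 0 < a := one_pos.trans_le ha
  -- the junk-free ground-state clause IS `IsWeilGroundState` (refuter's `isGroundStateJF_iff`)
  have hu' : IsWeilGroundState a u :=
    ⟨hu2, g, hg, (forall_eventually_le_iff_tendsto_weilGroundEnergy hg).1 hmin, hL⟩
  have hfloor := neg_le_weilGroundEnergy_of_floor ha0 (groundBartaRate_nonneg a)
    (fun t ht => groundThetaImage_floor ha0 ht) hu' hsign
  exact hfloor.trans (weilGroundEnergy_le_of_sphere hh hs hnorm)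

end Summit.RiemannHypothesis.RiemannHypothesis.Cruxes.GroundBartaFloor.PhiWindowSupersolution

end
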